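import Summits.Ventures.QEC.Census.AdditiveCertBZSound
import Summits.Ventures.QEC.Census.AdditiveN30.HeavyC30N25K1Defs
import Summits.Ventures.QEC.Census.AdditiveN30.HeavyC30N25K1M0
import Summits.Ventures.QEC.Census.AdditiveN30.HeavyC30N25K1M1
import Summits.Ventures.QEC.Census.AdditiveN30.HeavyC30N25K1M2
import HarnessLib

/-!
# Census object `c30_n25_k1` (`[[25,1,9]]`): KERNEL-std `[[n,k,d]]` and exact distance (assembly) (theorems only)

LADDER-QEC census cell C.1, `n ≤ 30`; item 02.C1LOWb slice (e) (qec-type-02 gen 4). The certificate `cert_c30_n25_k1` and BZ data `bz_c30_n25_k1`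
are the definitions of `Census/AdditiveN30/HeavyC30N25K1Defs.lean` (the object has 2325 stabilizers of weight `≤ 8` — too many
for literals, and each is a straggler of the lane replay, so the matrices are filed one per module to keep every module under the farm budget).
This module: `structBZ_c30_n25_k1` (`checkBZ`) and the assembly of the 3 matrix verdicts of `HeavyC30N25K1M0..M2.lean` into `isAdditiveCode_c30_n25_k1` / `minDistance_c30_n25_k1`. Brouwer–Zimmermann on the `75`-bit image (qec-type-02's `Census/AdditiveCertBZ*.lean`; lane engine qec-type-01's `Plane.segOK`;
threshold `16 = 2(d−1)`). Tier KERNEL-std, axioms ⊆ {propext, Classical.choice, Quot.sound}, no `native_decide`. HONEST FRAMING: existence /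
exact distance for this explicit census object; optimality of the cell `(25, 1)` is the LP column. [folklore]; table compared:
[cite: CalderbankEtAl1998, §8 Table III (printed pp. 32–34)].
-/

set_option autoImplicit false
set_option Elab.async false

namespace Summit.Ventures.QEC.Census.AdditiveN30

open Summit.Ventures.QEC.Census Literature.InformationTheory.QuantumCodes

set_option maxRecDepth 100000 in
/-- All structural checks of the BZ branch pass for `cert_c30_n25_k1` / `bz_c30_n25_k1` (`decide +kernel`). [folklore] -/
theorem structBZ_c30_n25_k1 : cert_c30_n25_k1.checkBZ bz_c30_n25_k1 = true := by
  decide +kernel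

/-- **`c30_n25_k1` is an `[[25, 1, 9]]` additive code** (CRSS Thm 1 sense) — Brouwer–Zimmermann on the `75`-bit image, tier KERNEL-std. [folklore] -/
theorem isAdditiveCode_c30_n25_k1 : IsAdditiveCode cert_c30_n25_k1.code 1 9 :=
  cert_c30_n25_k1.isAdditiveCode_of_bz bz_c30_n25_k1 structBZ_c30_n25_k1
    (cert_c30_n25_k1.bzEnum_upto_succ bz_c30_n25_k1 (cert_c30_n25_k1.bzEnum_upto_succ bz_c30_n25_k1 (cert_c30_n25_k1.bzEnum_upto_succ bz_c30_n25_k1 (cert_c30_n25_k1.bzEnum_upto_zero bz_c30_n25_k1) enum_c30_n25_k1_0) enum_c30_n25_k1_1) enum_c30_n25_k1_2)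

/-- … with minimum distance EXACTLY `9` (KERNEL-std). [folklore] -/
theorem minDistance_c30_n25_k1 : minDistance cert_c30_n25_k1.code = 9 :=
  cert_c30_n25_k1.minDistance_code_of_bz bz_c30_n25_k1 structBZ_c30_n25_k1
    (cert_c30_n25_k1.bzEnum_upto_succ bz_c30_n25_k1 (cert_c30_n25_k1.bzEnum_upto_succ bz_c30_n25_k1 (cert_c30_n25_k1.bzEnum_upto_succ bz_c30_n25_k1 (cert_c30_n25_k1.bzEnum_upto_zero bz_c30_n25_k1) enum_c30_n25_k1_0) enum_c30_n25_k1_1) enum_c30_n25_k1_2) (by decide)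

end Summit.Ventures.QEC.Census.AdditiveN30
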